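import Summits.MatrixMultiplication.OmegaCensus.STPP211Z2pow6DirectChunks
import Summits.MatrixMultiplication.OmegaCensus.STPP211Z2pow6Hard06Decide3

/-!
# (2,1,1)¹⁰ ⊄ (ℤ/2)⁶ — part S2 class 06, decisions 4/5: direct search over the hard class #20 of `reps29` (roots d = 48 (part))

Cell `pub-omega` (unit `pub-omega-stpp-1-g37`), topic `Summits/MatrixMultiplication/OmegaCensus`.
HONEST FRAMING (verbatim): lottery ticket; floor = certified bounds/negative ranges. Census STRUCTURE bookkeeping (B5, `T1((ℤ/2)⁶)`, Pb237);
nothing here is a bound on `ω`.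

Class #20 of `reps29` in the translated form `C' = hc06 = [0, 7, 11, 13, 14, 15, 24, 31, 40, 47]` (`+ 15`, block of `c = 15` first; linear stabilizer of order 192,
root representatives [1, 8, 16, 25, 48, 49, 56]; HOME `pub-omega-stpp-1-g36/code/hard_perd.json`). The kernel evaluates the direct engine
(`STPP211Z2pow6DirectEngine.rootD`, soundness `noNF_of_rootD`) in CHUNKS of the root node (`STPP211Z2pow6DirectChunks.rootDX`, ≤ 10⁵ search
calls each, exact counts from the seat's C mirror `godc.c`; this file: 175,851 calls) and assembles `rootD C' d = true` per root by
`rootD_of_chunks`. The class theorem follows in `STPP211Z2pow6Hard06Class` (symmetry transport, `STPP211Z2pow6DirectTransport`).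

References: H. Cohn, R. Kleinberg, B. Szegedy, C. Umans, FOCS 2005 (arXiv:math/0511460), Def. 5.1.
-/

namespace Summit.MatrixMultiplication.OmegaCensus

namespace T1CosetEng

/-- KERNEL: root `d = 48`, chunk 11 (codes `x = 34 … 41` of the branching label's lane; 83,513 search calls). -/
theorem hc06_d48_c11 : rootDX [0, 7, 11, 13, 14, 15, 24, 31, 40, 47] 48 4380866641920 = true := by decide +kernel

/-- KERNEL: root `d = 48`, chunk 12 (codes `x = 42 … 63` of the branching label's lane; 92,338 search calls). -/
theorem hc06_d48_c12 : rootDX [0, 7, 11, 13, 14, 15, 24, 31, 40, 47] 48 18446739675663040512 = true := by decide +kernel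

/-- KERNEL (assembled): the direct search from the root `A₀ = {0, dec 48}` refutes every normal-form family over `C'`. -/
theorem hc06_d48 : rootD [0, 7, 11, 13, 14, 15, 24, 31, 40, 47] 48 = true :=
  rootD_of_chunks [0, 7, 11, 13, 14, 15, 24, 31, 40, 47] 48 [3, 4, 8, 496, 512, 130048, 4063232, 62914560, 469762048, 16642998272, 4380866641920, 18446739675663040512] (by decide) (cover_of_all64 _ (by decide)) (by
    intro M hM
    simp only [List.mem_cons, List.not_mem_nil, or_false] at hM
    rcases hM with rfl | rfl | rfl | rfl | rfl | rfl | rfl | rfl | rfl | rfl | rfl | rfl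
    exacts [hc06_d48_c1, hc06_d48_c2, hc06_d48_c3, hc06_d48_c4, hc06_d48_c5, hc06_d48_c6, hc06_d48_c7, hc06_d48_c8, hc06_d48_c9, hc06_d48_c10, hc06_d48_c11, hc06_d48_c12])

end T1CosetEng

end Summit.MatrixMultiplication.OmegaCensus
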